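import Summits.HodgeConjecture.HodgeConjecture.Theorems.R90S5XiStringOfEnvelope   -- ★ p03 (g0): the ONE-PLACE engine `xiString_clFinChoice_eq_recordπn_of_routesAt`; brings ★ `RoutesAt`, `clFinChoice`, `xiFamilyOfRecord`, `ramOfRecord`, `finite_setOf_not_good`, E1 `evpAtIntegralLevel`, `evpOfClass_congr`, (SqNS♭)
import HarnessLib

/-!
# R90-TF · S5 «Ch. 13.3» · DEAL #5 (i): A.E. ROUTING ⇒ THE E.V.P. OF `P` IS THE RECORD ξ-STRING — `t(P) = t(⊗_v πⁿ(ξ_v))` for EVERY hermitian `H`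
# (Rogawski 1990, §13.6 p. 209 «`π` unramified off `S` defines an e.v.p. `t(π)`»; §13.3 p. 201; §14.6 (14.6.2) p. 241 «`t_{S′}(π′) = t_{S′}(Π)`»; Thm. 14.6.4 p. 243 proof l. 1)

Cell `hodgecm-mathlib`, programme R90-TF (brief `director/R90-BRIEF.v2.md`), section S5 (base `R90-C133`), prover seat R90-C133-p02 (g0) on the section planner's
DEAL #5 (2026-09-04T15:43:54Z) item (i): «WHILE p01's pins file is in flight land the ★-closable E1-currency lemma `evp_eq_record_of_ae_routesAt` for EVERY `H` (general inner
form — S9 consumes it too), from p03's ★ §1 engine + ★ `finite_setOf_not_good`».  Crux item `stmt-HodgeConjecture-24833` (h413); `--supports` helper, closes nothing by itself.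
PROOF LANE: theorems only (no `def`, no instance declaration, no notation, no `sorry`); ★ `Theorems` imports only.

WHERE IT SITS.  The S5#2 cut (★ `R90S5XiMembershipOfArchJOfString`, p861428) and the FIN cut (★ `R90S5S2FinOfRoutingCot`, p861453) have the input (U-R) «A-PACKET RIGIDITY»:
`(∀ v ∉ S₁, RoutesAt … P ξ v) → MemXiFamily P … ξ` [Thm. 14.6.4 ∘ 13.3.5].  Its payer (p02's DEAL #5 (ii) on `U(Φ₃)`; S9∕S7 on a general `U(H)`) STARTS by turning the a.e. routing
into the eigenvalue string `t(P) = t(Π(ξ))` that the comparison (13.7 (3) ∕ (14.6.2)) reads — this file is that first step, HYPOTHESIS = the routing ALONE (no `MemXiFamily`, no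
spherical supply: a routed class IS the record's spherical member at every good place), for every hermitian `H` with unit determinant.

THE MATHEMATICS.  Let `P` be a discrete automorphic representation of `U(H)` ROUTED by `ξ` off a finite `S₁` (★ `RoutesAt`: at a split `v ∉ S₁` the chosen class ★ `clFinChoice P v`
is the member of the D6 split packet at the fixed witness; at a non-split `v ∉ S₁` it is Keys' non-`L²` label `πⁿ` transported along every level-matching form congruence).
At every GOOD place of the record (`v ∉ ramOfRecord ξ`: `η̃, ψ̃, μ` unramified above `v`, `H_w ∈ GL₃(𝒪_w)`, and at non-split `v` a level-matching congruence with `η_v = ψ_v = 1`;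
cofinite by ★ `finite_setOf_not_good`) at which (SqNS♭) holds (cofinite and hypothesis-free, ★ `squareIntegrableNotSpherical_nonsplit_cofinite`), p03's ★ engine gives
`clFinChoice P v = (xiFamilyOfRecord ξ v).πn`, and the record's member there is admissible and `U(H)(𝒪_v)`-spherical (★ `isAdmissible_isSpherical_πn_xiFamilyOfRecord_of_good`).
So off the finite `S₀ := S₁ ∪ ramOfRecord ξ ∪ {(SqNS♭) exceptions}` both families are spherical and EQUAL, and for every `S ⊇ S₀` the E1 eigenvalue packages at the integral
levels coincide (★ `evpOfClass_congr`): `t(P) = t(⊗_v πⁿ(ξ_v))` [§13.6 p. 209] — print's «`t_{S′}(π′) = t_{S′}(Π(ξ))`» [(14.6.2), Thm. 14.6.4 proof l. 1], whose base change is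
`ψ_G(t(P)) = t(I_{ξ̃′})` [Prop. 13.2.2 (d)].

CONTENTS (V6 frame `(L, H, hH, hHd, μω, hμu, μZ, keys, μ)` of ★ `RoutesAt`, all sorry-free):
* §1 `eventually_clFinChoice_eq_recordπn_of_ae_routesAt` — a.e. routing ⇒ `∀ᶠ v`, the record's `πⁿ(ξ_v)` is `U(H)(𝒪_v)`-spherical and `clFinChoice P v = (xiFamilyOfRecord ξ v).πn`.
* §2 `evp_eq_record_of_ae_routesAt` — a.e. routing ⇒ `∃ S₀` off which both families are spherical and equal, and `∀ S ⊇ S₀`, `∀ hP hξ`,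
  `evpAtIntegralLevel L 3 H (clFinChoice P ·) S hP = evpAtIntegralLevel L 3 H ((xiFamilyOfRecord ξ ·).πn) S hξ` (the DEAL #5 (i) text).
HONEST LABEL: HC_CM is proved only modulo the 7 printed citations (2 remaining named inputs: hLiu418 = stmt-HodgeConjecture-24832, h413 = stmt-HodgeConjecture-24833) until rung 0
closes; REL ≠ ★ ≠ BUILT — a book-keeping lemma in E1 currency, no leaf moves.

References: [Rogawski1990] J. Rogawski, *Automorphic Representations of Unitary Groups in Three Variables*, Ann. of Math. Stud. 123 (1990): §13.6 pp. 209–210; §13.3 p. 201,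
Thm. 13.3.5 p. 202; §14.6 (14.6.2) p. 241, Thm. 14.6.4 p. 243; Prop. 13.2.2 (d) p. 201; §12.2 (2) pp. 173–174; §13.1 p. 199.  [CartierCorvallis1979] P. Cartier,
*Representations of 𝔭-adic groups: a survey*, PSPM 33.1 (1979), §IV.1 Cor. 4.1.  [Macdonald1971] I. G. Macdonald, *Spherical functions on a group of 𝔭-adic type* (1971), Ch. V §3.
-/

set_option autoImplicit false
-- the mandated namespace repeats the single-problem summit's segment (`HodgeConjecture.HodgeConjecture`)
set_option linter.dupNamespace false

noncomputable section

open NumberField IsDedekindDomain MeasureTheory Filter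
open Literature.NumberTheory.Rogawski1990 Literature.NumberTheory.GaloisRepresentations
open Literature.NumberTheory.Automorphic Literature.NumberTheory.Automorphic.UnitaryGroup
open scoped Matrix Classical ComplexOrder

namespace Summit.HodgeConjecture.HodgeConjecture.R90.S5

open Summit.HodgeConjecture.HodgeConjecture.Cruxes.H413
open Summit.HodgeConjecture.HodgeConjecture.Cruxes.H413.F0P3InnerFormClassificationV6
open Summit.HodgeConjecture.HodgeConjecture.Cruxes.H413.F0P3ClassTokenChoice (clFinChoice)
open Summit.HodgeConjecture.HodgeConjecture.Cruxes.H413.F0P3CohClassRoutingCot (RoutesAt)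
open Summit.HodgeConjecture.HodgeConjecture.Cruxes.H413.F0P3XiLocalFamilyOfRecord (xiFamilyOfRecord ramOfRecord finite_setOf_not_good
  isAdmissible_isSpherical_πn_xiFamilyOfRecord_of_good)
open Summit.HodgeConjecture.HodgeConjecture.Cruxes.H413.K2E1EvpOfAutomorphicClass (evpAtIntegralLevel evpOfClass_congr)

variable (L : Type) [Field L] [NumberField L] [IsCMField L] (H : Matrix (Fin 3) (Fin 3) L)
  (hH : (H.map (cmConjRingHom L))ᵀ = H) (hHd : IsUnit H.det) (μω : HeckeCharacter L) (hμu : μω.IsUnitary)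
  [∀ v : HeightOneSpectrum (𝓞 ↥(maximalRealSubfield L)), MeasurableSpace (Gqs L v ⧸ Subgroup.center (Gqs L v))]
  [∀ v : HeightOneSpectrum (𝓞 ↥(maximalRealSubfield L)), BorelSpace (Gqs L v ⧸ Subgroup.center (Gqs L v))]
  (μZ : ∀ v : HeightOneSpectrum (𝓞 ↥(maximalRealSubfield L)), Measure (Gqs L v ⧸ Subgroup.center (Gqs L v)))
  [∀ v : HeightOneSpectrum (𝓞 ↥(maximalRealSubfield L)), (μZ v).IsHaarMeasure]
  (keys : ∀ (ξ : OneDimAutRepH L) (v : HeightOneSpectrum (𝓞 ↥(maximalRealSubfield L))),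
    (∀ w : PlacesOver L v, IsCMField.complexConj L • w.1 = w.1) →
      {p : IrrClass (Gqs L v) × IrrClass (Gqs L v) //
        KeysCaseTwoLabels L v (μω.semilocalComponent L v) (torusLocalComponent L (IsCMField.complexConj L) v ξ.η)
          (torusLocalComponent L (IsCMField.complexConj L) v ξ.ψ) p.1 p.2 ∧
        p.1.IsSquareIntegrable (μZ v) ∧ ¬ p.2.IsSquareIntegrable (μZ v)})
  (μ : Measure (Gp L H).automorphicQuotient) [(Gp L H).IsAutomorphicMeasure μ]

/-! ## §1 A.e. routing ⇒ a.e. equality with the record's spherical member -/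

include μZ keys in
/-- **A ROUTED `P` IS THE RECORD ξ-STRING, CLASS BY CLASS, AT ALL BUT FINITELY MANY PLACES.**  If a discrete `P` of `U(H)` is routed by `ξ` off a finite `S₁` (★ `RoutesAt`), then at
all but finitely many finite places `v` of `L⁺` the record's member `πⁿ(ξ_v)` (★ `xiFamilyOfRecord ξ v`) is `U(H)(𝒪_v)`-spherical AND the chosen class ★ `clFinChoice P v` equals it.
Exceptions ⊆ `S₁ ∪ ramOfRecord ξ ∪ {(SqNS♭) fails}` (★ `finite_setOf_not_good`, ★ `squareIntegrableNotSpherical_nonsplit_cofinite`); at a good place p03's ★ one-place engine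
`xiString_clFinChoice_eq_recordπn_of_routesAt` and ★ `isAdmissible_isSpherical_πn_xiFamilyOfRecord_of_good`.  No `MemXiFamily`, no spherical supply assumed.
[cite: Rogawski1990, §13.3 p. 201; §13.1 p. 199; §12.2 (2) pp. 173–174; §13.6 p. 209] [cite: Macdonald1971, Ch. V §3] -/
theorem eventually_clFinChoice_eq_recordπn_of_ae_routesAt (P : DiscreteAutomorphicRep (Gp L H) μ) (ξ : OneDimAutRepH L)
    (S₁ : Finset (HeightOneSpectrum (𝓞 ↥(maximalRealSubfield L))))
    (hroute : ∀ v : HeightOneSpectrum (𝓞 ↥(maximalRealSubfield L)), v ∉ S₁ → RoutesAt L H hH hHd μω hμu μZ keys μ P ξ v) :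
    ∀ᶠ v : HeightOneSpectrum (𝓞 ↥(maximalRealSubfield L)) in cofinite,
      (xiFamilyOfRecord L H hH hHd μω hμu ξ v).πn.IsSpherical (cmLocalIntegralLevel L 3 H v) ∧
        clFinChoice P v = (xiFamilyOfRecord L H hH hHd μω hμu ξ v).πn := by
  have hgood := finite_setOf_not_good L H hH hHd μω ξ
  rw [← Filter.eventually_cofinite] at hgood
  filter_upwards [S₁.eventually_cofinite_notMem, hgood,
    F0P3SqIntNotSphericalNonsplitCofinite.squareIntegrableNotSpherical_nonsplit_cofinite L] with v hv₁ hv₃ hv₄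
  have hram : v ∉ ramOfRecord L H hH hHd μω ξ := by
    rw [ramOfRecord, Set.Finite.mem_toFinset, Set.mem_setOf_eq, not_not]
    exact hv₃
  exact ⟨(isAdmissible_isSpherical_πn_xiFamilyOfRecord_of_good L H hH hHd μω hμu ξ v hv₃).2,
    xiString_clFinChoice_eq_recordπn_of_routesAt L H hH hHd μω hμu μZ keys μ P ξ v (hroute v hv₁) hram hv₄⟩

/-! ## §2 A.e. routing ⇒ `t(P) = t(⊗_v πⁿ(ξ_v))` as E1 eigenvalue packages off a finite set (DEAL #5 (i)) -/

include μZ keys in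
/-- **DEAL #5 (i) — `evp_eq_record_of_ae_routesAt`: A ROUTED `P` HAS THE EIGENVALUE PACKAGE OF `Π(ξ)`.**  If a discrete `P` of `U(H)` (ANY hermitian `H` with unit determinant —
a general inner form) is routed by `ξ` off a finite `S₁` (★ `RoutesAt`), there is a finite `S₀` of finite places of `L⁺` such that (i) off `S₀` the chosen classes of `P` and the
record's `πⁿ(ξ_v)` are `U(H)(𝒪_v)`-spherical and EQUAL, and (ii) for EVERY `S ⊇ S₀` and all proofs of sphericity off `S` the E1 eigenvalue packages at the integral levels coincide:
`evpAtIntegralLevel L 3 H (clFinChoice P ·) S hP = evpAtIntegralLevel L 3 H ((xiFamilyOfRecord ξ ·).πn) S hξ` — print's string `t(P) = t(Π(ξ))` [(14.6.2); Thm. 14.6.4 proof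
l. 1; §13.6 p. 209], base change `ψ_G(t(P)) = t(I_{ξ̃′})` [Prop. 13.2.2 (d)].  From §1 and ★ `evpOfClass_congr`.  (The converse rigidity «string ⇒ `MemXiFamily`» is (U-R)'s
trace-formula half — DEAL #5 (ii) on `U(Φ₃)`, S9∕S7 in general — and is NOT claimed here.)
[cite: Rogawski1990, §13.6 pp. 209–210; §14.6 (14.6.2) p. 241, Thm. 14.6.4 p. 243; Prop. 13.2.2 (d) p. 201; §13.3 Thm. 13.3.5 p. 202] [cite: CartierCorvallis1979, §IV.1 Cor. 4.1] -/
theorem evp_eq_record_of_ae_routesAt (P : DiscreteAutomorphicRep (Gp L H) μ) (ξ : OneDimAutRepH L)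
    (S₁ : Finset (HeightOneSpectrum (𝓞 ↥(maximalRealSubfield L))))
    (hroute : ∀ v : HeightOneSpectrum (𝓞 ↥(maximalRealSubfield L)), v ∉ S₁ → RoutesAt L H hH hHd μω hμu μZ keys μ P ξ v) :
    ∃ S₀ : Finset (HeightOneSpectrum (𝓞 ↥(maximalRealSubfield L))),
      (∀ v : HeightOneSpectrum (𝓞 ↥(maximalRealSubfield L)), v ∉ S₀ →
        (clFinChoice P v).IsSpherical (cmLocalIntegralLevel L 3 H v) ∧
          (xiFamilyOfRecord L H hH hHd μω hμu ξ v).πn.IsSpherical (cmLocalIntegralLevel L 3 H v) ∧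
          clFinChoice P v = (xiFamilyOfRecord L H hH hHd μω hμu ξ v).πn) ∧
      ∀ (S : Set (HeightOneSpectrum (𝓞 ↥(maximalRealSubfield L)))), (↑S₀ : Set _) ⊆ S →
        ∀ (hP : ∀ v, v ∉ S → (clFinChoice P v).IsSpherical (cmLocalIntegralLevel L 3 H v))
          (hξ : ∀ v, v ∉ S → (xiFamilyOfRecord L H hH hHd μω hμu ξ v).πn.IsSpherical (cmLocalIntegralLevel L 3 H v)),
          evpAtIntegralLevel L 3 H (fun v => clFinChoice P v) S hP =
            evpAtIntegralLevel L 3 H (fun v => (xiFamilyOfRecord L H hH hHd μω hμu ξ v).πn) S hξ := by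
  have hev := Filter.eventually_cofinite.1 (eventually_clFinChoice_eq_recordπn_of_ae_routesAt L H hH hHd μω hμu μZ keys μ P ξ S₁ hroute)
  refine ⟨hev.toFinset, fun v hv => ?_, fun S hS hP hξ => ?_⟩
  · have hv' : (xiFamilyOfRecord L H hH hHd μω hμu ξ v).πn.IsSpherical (cmLocalIntegralLevel L 3 H v) ∧
        clFinChoice P v = (xiFamilyOfRecord L H hH hHd μω hμu ξ v).πn := by
      by_contra hc
      exact hv (hev.mem_toFinset.2 hc)
    exact ⟨hv'.2 ▸ hv'.1, hv'.1, hv'.2⟩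
  · refine evpOfClass_congr L 3 H _ hP hξ fun v hv => ?_
    have hv₀ : v ∉ hev.toFinset := fun h => hv (hS h)
    have hv' : (xiFamilyOfRecord L H hH hHd μω hμu ξ v).πn.IsSpherical (cmLocalIntegralLevel L 3 H v) ∧
        clFinChoice P v = (xiFamilyOfRecord L H hH hHd μω hμu ξ v).πn := by
      by_contra hc
      exact hv₀ (hev.mem_toFinset.2 hc)
    exact hv'.2

end Summit.HodgeConjecture.HodgeConjecture.R90.S5

end
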